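import Summits.NavierStokesRegularity.NavierStokesRegularity.Theses.SwirlThreshold

/-!
# `SmallSwirlFailureBlowup` — two-sidedness glue of route SwirlThreshold

Item stmt-NavierStokesRegularity-2005 (support). Pure logic: the negation of the absolute
small-swirl regularity statement (`SmallSwirlRegularity`, verbatim) yields an axisymmetric
blow-up witness (`AxisymBlowup`, verbatim stmt-NavierStokesRegularity-0727). Take `ε = 1`;
a classical solution on `[0, T)` admitting no smooth extension past `T` is an
`IsMaximalSmoothSolution` by definition
(`Literature.Analysis.FluidPDE.IsMaximalSmoothSolution`, Beale–Kato–Majda vocabulary).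
-/

-- the summit and its single problem share the name (D-0017 nested layout)
set_option linter.dupNamespace false

namespace Summit.NavierStokesRegularity.NavierStokesRegularity.Theorems

open Summit.NavierStokesRegularity.NavierStokesRegularity.Theses.SwirlThreshold

/-- **Two-sidedness glue** (item stmt-NavierStokesRegularity-2005): if absolute small-swirl
regularity fails, then some finite-energy classical Navier–Stokes solution from a rapidly
decaying axisymmetric datum is a maximal smooth solution with finite lifespan, i.e.
`AxisymBlowup` holds. Proof: contrapositive with `ε = 1`; non-extendability past `T` together
with being a classical solution on `[0, T)` is `IsMaximalSmoothSolution` by definition. -/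
theorem smallSwirlFailureBlowup_proof : SmallSwirlFailureBlowup := by
  unfold SmallSwirlFailureBlowup
  intro h
  by_contra hcon
  apply h
  refine ⟨1, one_pos, ?_⟩
  intro ν T hν hT u p hcls hLH hdec hax _hsw
  by_contra hext
  exact hcon ⟨ν, hν, T, hT, u, p, ⟨hcls, hext⟩, hLH, hdec, hax⟩

end Summit.NavierStokesRegularity.NavierStokesRegularity.Theorems
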